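import Literature.AlgebraicGeometry.Motives.PoincareUniversal.ModelTowerInstance
import Literature.AlgebraicGeometry.Motives.ConstantFamilyFibre
import Literature.AlgebraicGeometry.AbelianVarieties.PoincareSheafSlicesPoints
import Literature.AlgebraicGeometry.AbelianSchemes.RigidifiedLineBundleSliceHomogeneous
import HarnessLib

/-!
# M13 — the level-zero data of the model tower: the graph point over `y₀ = pt b`, `𝒫|_{A₀ × b} ≅ ℒ|_{A₀ × x}`, and the level-`0` frames

The base case of the M13 lift induction ([MumfordAV1970] §13, proof of the Theorem pp. 125–130: the graph point over the
REDUCED point; [GortzWedhorn2023] Lemma 24.72, proof, Step (I)) in the currency of `PoincareUniversal.ModelTowerInstance`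
(`Yn/rn/Ln`, the Artinian charts `sB/YBn/jBn/PBn` of `Â = A₀.dualOf Θ hΘ` at a closed `y₀`, the classifying maps `gφn/ptn`):
for a `ℂ`-point `b` of `Â` centred at `y₀` — the slice `sliceMor A₀ c : A₀ → A₀ × Z` at a `ℂ`-point (`whiskerLeft_toSpecOver_comp`),
the augmentation `ρpt : 𝒪_{Â,y₀}/𝔪 → ℂ` of `b` (★ `artinianFactor` at level `0`, `maximalIdeal_complex_pow`) and **the level-`0`
chart point `φ₀pt : 𝒪_{Â,y₀}/𝔪 → ℂ → 𝒪_{T,t}/𝔪`** with `ptn_φ₀pt : pt φ₀ = (· → Spec ℂ) ≫ b`, `gφn_φ₀pt_jBn`, `rn_zero_eq`;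
**the level-`0` graph isomorphism `baseIso : (gφ₀)^*𝒫| ≅ ℒ|`** from a slice isomorphism `ψ : 𝒫|_{A₀ × b} ≅ ℒ|_{A₀ × x}` (`x` the
`ℂ`-point of `T′` through `t`) and **the `base` input** `base_of_sliceIso` of `GammaInputs` (given the uniqueness of
`ℂ`-augmentations of `𝒪_{Â,y₀}/𝔪`); the level-`0` frames **`framesL0`** (frames of `ℒ|_{A₀ × Spec κ(t)}` on `pr⁻¹V` from frames of
the slice on `V`) and **`framesP0`** (frames of `𝒫|_{A₀ × Spec κ(y₀)}`, through `isIso_artinianFactorOver` /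
`thickeningPtι_zero_eq` / `jBn_zero_eq` when `𝒪_{Â,y₀}/𝔪 = ℂ`); and **`exists_point_sliceIso`**: for `ℒ` fibrewise in `Pic⁰`
and every `ℂ`-point `x` of `T′` there is a `ℂ`-point `b` of `Â` with `𝒫|_{A₀ × b} ≅ ℒ|_{A₀ × x}` ([MumfordAV1970] §8 Thm. 1 over `ℂ`:
★ `exists_detClass_eq_detClass_pullback_sliceAt` + ★ `nonempty_iso_iff_detClass_eq`).  Definitions with bodies + theorems; no
socket, no named fact, no instance.  Cell `hodgecm-mathlib`, M13 node N3 (3c) (γ6); source B-p20 (g7) v4 231f040e § Gamma6,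
cut B-p13 (g15).
HC_CM is proved only modulo the 7 printed citations until rung 0 closes.

## References
* [MumfordAV1970] D. Mumford, *Abelian Varieties* (1970), §8 Thm. 1 (p. 77); §13 (proof of the Thm. pp. 125–130).
* [GortzWedhorn2023] U. Görtz, T. Wedhorn, *Algebraic Geometry II* (2023), Lemma 24.72 (p. 409) and its proof, Step (I) (p. 410).
-/

noncomputable section

universe u v

open TensorProduct CategoryTheory AlgebraicGeometry
open Literature.RingTheory.Flat Literature.RingTheory.Flat.IsSmallExtension

namespace Literature.AlgebraicGeometry.Motives.AbelianVariety

open CategoryTheory CategoryTheory.Limits AlgebraicGeometry MonoidalCategory CartesianMonoidalCategory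
open Literature.AlgebraicGeometry.AbelianSchemes Literature.AlgebraicGeometry.AbelianVarieties
  Literature.AlgebraicGeometry.Modules Literature.AlgebraicGeometry.Morphisms
  Literature.AlgebraicGeometry.Morphisms.CechUnitCocycle IsLocalRing

section GammaInstance

variable (A₀ : AbelianVariety ℂ) {Θ : CartierDivisor A₀.X.left} (hΘ : Θ.IsAmple)
  (P : (A₀.X ⊗ (A₀.dualOf Θ hΘ).X).left.Modules)
  (T' : SchemeOver ℂ) (ℒ : (AbelianSchemeOver.ofAbelianVariety A₀).RigidifiedLineBundle T'.hom)
  (t : T'.left) [LocallyOfFiniteType T'.hom] [IsLocallyNoetherian T'.left] (ht : IsClosed ({t} : Set T'.left))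
  {ι : Type} (V : ι → A₀.X.left.Opens) (hV : ∀ a, IsAffineOpen (V a))
  (y₀ : (A₀.dualOf Θ hΘ).X.left) [LocallyOfFiniteType (A₀.dualOf Θ hΘ).X.hom]
  [IsLocallyNoetherian (A₀.dualOf Θ hΘ).X.left] (hy₀ : IsClosed ({y₀} : Set (A₀.dualOf Θ hΘ).X.left))
  [IsSeparated A₀.X.hom]

/-! ### (γ6) THE LEVEL-ZERO DATA: the graph point over `y₀ = pt b`, `𝒫|_{A₀ × b} ≅ ℒ|_{A₀ × t}` (★ Mumford §8 Thm. 1 /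
S4 of ★ `exists_unique_classify_of_normal`), and the level-`0` frames -/

section Gamma6

variable {ι : Type} (V : ι → A₀.X.left.Opens)

/-- The slice `A₀ → A₀ × Z`, `a ↦ (a, c)` at a `ℂ`-point `c` of `Z` (★ `PoincareSheafSlicesPoints` spelling). [folklore] -/
abbrev sliceMor {Z : SchemeOver ℂ} (c : specOver ℂ ℂ ⟶ Z) : A₀.X ⟶ A₀.X ⊗ Z :=
  CartesianMonoidalCategory.lift (𝟙 A₀.X) (toSpecOver A₀.X ≫ c)

omit [LocallyOfFiniteType T'.hom] [IsLocallyNoetherian T'.left] [LocallyOfFiniteType (A₀.dualOf Θ hΘ).X.hom]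
  [IsLocallyNoetherian (A₀.dualOf Θ hΘ).X.left] [IsSeparated A₀.X.hom] in
/-- `A₀ × (S → Spec ℂ → Z) = pr₁ ≫ slice` (the point `Spec ℂ` is terminal among `ℂ`-schemes). [cite: MumfordAV1970, §13 (proof of the Thm. pp. 125–130)] -/
theorem whiskerLeft_toSpecOver_comp {S Z : SchemeOver ℂ} (c : specOver ℂ ℂ ⟶ Z) :
    A₀.X ◁ (toSpecOver S ≫ c) = CartesianMonoidalCategory.fst A₀.X S ≫ sliceMor A₀ c := by
  apply CartesianMonoidalCategory.hom_ext
  · rw [whiskerLeft_fst, Category.assoc, lift_fst, Category.comp_id]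
  · rw [whiskerLeft_snd, Category.assoc, lift_snd, ← Category.assoc, ← Category.assoc]
    congr 1
    exact Subsingleton.elim _ _

/-- `𝔪_ℂ^{0+1} = 0`. [cite: MumfordAV1970, §13 (proof of the Thm. pp. 125–130)] -/
theorem maximalIdeal_complex_pow : IsLocalRing.maximalIdeal ℂ ^ (0 + 1) = ⊥ := by
  rw [zero_add, pow_one]
  exact IsLocalRing.isField_iff_maximalIdeal_eq.mp (Field.toIsField ℂ)

variable (b : AlgPoints (A₀.dualOf Θ hΘ).X ℂ) (hb : b.left (IsLocalRing.closedPoint ℂ) = y₀)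

/-- The `ℂ`-algebra map `𝒪_{Â,y₀}/𝔪 → ℂ` of the `ℂ`-point `b` centred at `y₀` (α7 at level `0`). [folklore] -/
def ρpt : Rt (A₀.dualOf Θ hΘ).X y₀ 0 →ₐ[ℂ] ℂ :=
  artinianFactor (A₀.dualOf Θ hΘ).X (topPt (A₀.dualOf Θ hΘ).X y₀) b.left hb (Over.w b) 0
    maximalIdeal_complex_pow

/-- **The level-`0` chart point `φ₀ : 𝒪_{Â,y₀}/𝔪 → ℂ → 𝒪_{T,t}/𝔪`.** [cite: MumfordAV1970, §13 (proof of the Thm. p. 125)] -/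
def φ₀pt : Rt (A₀.dualOf Θ hΘ).X y₀ 0 →ₐ[ℂ] Rt T' t 0 := (Algebra.ofId ℂ (Rt T' t 0)).comp (ρpt A₀ hΘ y₀ b hb)

omit [LocallyOfFiniteType T'.hom] [IsLocallyNoetherian T'.left] [LocallyOfFiniteType (A₀.dualOf Θ hΘ).X.hom]
  [IsLocallyNoetherian (A₀.dualOf Θ hΘ).X.left] [IsSeparated A₀.X.hom] in
/-- `Spec ρ_b ≫ (Spec 𝒪/𝔪 → Â) = b`. [cite: MumfordAV1970, §13 (proof of the Thm. pp. 125–130)] -/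
theorem Spec_map_ρpt_comp_ι :
    Spec.map (CommRingCat.ofHom (ρpt A₀ hΘ y₀ b hb).toRingHom) ≫ (thickeningPtι (A₀.dualOf Θ hΘ).X y₀ 0).left =
      b.left :=
  Spec_map_artinianFactor (A₀.dualOf Θ hΘ).X (topPt (A₀.dualOf Θ hΘ).X y₀) b.left hb (Over.w b) 0 _

omit [LocallyOfFiniteType T'.hom] [IsLocallyNoetherian T'.left] [LocallyOfFiniteType (A₀.dualOf Θ hΘ).X.hom]
  [IsLocallyNoetherian (A₀.dualOf Θ hΘ).X.left] [IsSeparated A₀.X.hom] in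
/-- **`pt φ₀ = (Spec 𝒪_{T,t}/𝔪 → Spec ℂ) ≫ b`.** [cite: MumfordAV1970, §13 (proof of the Thm. pp. 125–130)] -/
theorem ptn_φ₀pt : ptn A₀ hΘ T' t y₀ 0 0 (φ₀pt A₀ hΘ T' t y₀ b hb) = toSpecOver (thickeningPt T' t 0) ≫ b := by
  apply (Over.forget _).map_injective
  change Spec.map (CommRingCat.ofHom (φ₀pt A₀ hΘ T' t y₀ b hb).toRingHom) ≫
      (thickeningPtι (A₀.dualOf Θ hΘ).X y₀ 0).left = (toSpecOver (thickeningPt T' t 0)).left ≫ b.left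
  have : CommRingCat.ofHom (φ₀pt A₀ hΘ T' t y₀ b hb).toRingHom =
      CommRingCat.ofHom (ρpt A₀ hΘ y₀ b hb).toRingHom ≫ CommRingCat.ofHom (algebraMap ℂ (Rt T' t 0)) := rfl
  rw [this]
  erw [Spec.map_comp]
  rw [Category.assoc, Spec_map_ρpt_comp_ι, toSpecOver_left, thickeningPt_hom_eq]
  rfl

omit [LocallyOfFiniteType T'.hom] [IsLocallyNoetherian T'.left] [LocallyOfFiniteType (A₀.dualOf Θ hΘ).X.hom]
  [IsLocallyNoetherian (A₀.dualOf Θ hΘ).X.left] [IsSeparated A₀.X.hom] in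
/-- `gφ₀ ≫ jB 0 = pr₁ ≫ slice_b`. [cite: MumfordAV1970, §13 (proof of the Thm. pp. 125–130)] -/
theorem gφn_φ₀pt_jBn :
    gφn A₀ hΘ T' t y₀ 0 0 (φ₀pt A₀ hΘ T' t y₀ b hb) ≫ jBn A₀ hΘ y₀ 0 =
      (CartesianMonoidalCategory.fst A₀.X (thickeningPt T' t 0)).left ≫ (sliceMor A₀ b).left := by
  rw [gφn_jBn, ptn_φ₀pt, whiskerLeft_toSpecOver_comp]
  rfl

omit [LocallyOfFiniteType T'.hom] [IsLocallyNoetherian T'.left] [LocallyOfFiniteType (A₀.dualOf Θ hΘ).X.hom]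
  [IsLocallyNoetherian (A₀.dualOf Θ hΘ).X.left] [IsSeparated A₀.X.hom] in
/-- `r 0 = pr₁ ≫ slice_x` when the reduction `Spec κ(t) → T` is the `ℂ`-point `x`. [cite: MumfordAV1970, §13 (proof of the Thm. pp. 125–130)] -/
theorem rn_zero_eq (x : AlgPoints T' ℂ) (hx : thickeningPtι T' t 0 = toSpecOver (thickeningPt T' t 0) ≫ x) :
    rn A₀ T' t 0 = (CartesianMonoidalCategory.fst A₀.X (thickeningPt T' t 0)).left ≫ (sliceMor A₀ x).left := by
  rw [rn, hx, whiskerLeft_toSpecOver_comp]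
  rfl

/-- **THE LEVEL-`0` GRAPH ISOMORPHISM `(gφ₀)^*𝒫| ≅ ℒ|`** from a slice isomorphism `𝒫|_{A₀ × b} ≅ ℒ|_{A₀ × x}`.
[cite: MumfordAV1970, §13 (proof of the Thm. p. 125)] -/
def baseIso (x : AlgPoints T' ℂ) (hx : thickeningPtι T' t 0 = toSpecOver (thickeningPt T' t 0) ≫ x)
    (ψ : (Scheme.Modules.pullback (sliceMor A₀ b).left).obj P ≅ (Scheme.Modules.pullback (sliceMor A₀ x).left).obj ℒ.L) :
    (Scheme.Modules.pullback (gφn A₀ hΘ T' t y₀ 0 0 (φ₀pt A₀ hΘ T' t y₀ b hb))).obj (PBn A₀ hΘ P y₀ 0) ≅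
      Ln A₀ T' ℒ t 0 :=
  (Scheme.Modules.pullbackComp (gφn A₀ hΘ T' t y₀ 0 0 (φ₀pt A₀ hΘ T' t y₀ b hb)) (jBn A₀ hΘ y₀ 0)).app P ≪≫
    eqToIso (congrArg (fun k => (Scheme.Modules.pullback k).obj P) (gφn_φ₀pt_jBn A₀ hΘ T' t y₀ b hb)) ≪≫
    ((Scheme.Modules.pullbackComp (CartesianMonoidalCategory.fst A₀.X (thickeningPt T' t 0)).left
      (sliceMor A₀ b).left).app P).symm ≪≫
    (Scheme.Modules.pullback (CartesianMonoidalCategory.fst A₀.X (thickeningPt T' t 0)).left).mapIso ψ ≪≫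
    (Scheme.Modules.pullbackComp (CartesianMonoidalCategory.fst A₀.X (thickeningPt T' t 0)).left
      (sliceMor A₀ x).left).app ℒ.L ≪≫
    eqToIso (congrArg (fun k => (Scheme.Modules.pullback k).obj ℒ.L) (rn_zero_eq A₀ T' t x hx).symm)

omit [IsLocallyNoetherian T'.left] [LocallyOfFiniteType (A₀.dualOf Θ hΘ).X.hom]
  [IsLocallyNoetherian (A₀.dualOf Θ hΘ).X.left] [IsSeparated A₀.X.hom] in
/-- `ρ_T ∘ φ₀ = ρ_b`. [cite: MumfordAV1970, §13 (proof of the Thm. pp. 125–130)] -/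
theorem ρℂ_comp_φ₀pt : (ρℂ T' t ht 0).comp (φ₀pt A₀ hΘ T' t y₀ b hb) = ρpt A₀ hΘ y₀ b hb := by
  apply AlgHom.ext
  intro r
  exact AlgHom.commutes (ρℂ T' t ht 0) _

omit [IsLocallyNoetherian T'.left] [IsLocallyNoetherian (A₀.dualOf Θ hΘ).X.left] [IsSeparated A₀.X.hom] in
include hb in
/-- **THE `base` INPUT** from a slice isomorphism and the uniqueness of `ℂ`-augmentations of `𝒪_{Â,y₀}/𝔪 = ℂ`.
[cite: MumfordAV1970, §13 (proof of the Thm. p. 125)] -/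
theorem base_of_sliceIso (x : AlgPoints T' ℂ) (hx : thickeningPtι T' t 0 = toSpecOver (thickeningPt T' t 0) ≫ x)
    (ψ : (Scheme.Modules.pullback (sliceMor A₀ b).left).obj P ≅ (Scheme.Modules.pullback (sliceMor A₀ x).left).obj ℒ.L)
    (huniq : ∀ χ : Rt (A₀.dualOf Θ hΘ).X y₀ 0 →ₐ[ℂ] ℂ, χ = ρℂ (A₀.dualOf Θ hΘ).X y₀ hy₀ 0) :
    ∃ φ₀ : Rt (A₀.dualOf Θ hΘ).X y₀ 0 →ₐ[ℂ] Rt T' t 0,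
      Nonempty ((Scheme.Modules.pullback (gφn A₀ hΘ T' t y₀ 0 0 φ₀)).obj (PBn A₀ hΘ P y₀ 0) ≅ Ln A₀ T' ℒ t 0) ∧
        (ρℂ T' t ht 0).comp φ₀ = ρℂ (A₀.dualOf Θ hΘ).X y₀ hy₀ 0 :=
  ⟨φ₀pt A₀ hΘ T' t y₀ b hb, ⟨baseIso A₀ hΘ P T' ℒ t y₀ b hb x hx ψ⟩,
    (ρℂ_comp_φ₀pt A₀ hΘ T' t ht y₀ b hb).trans (huniq _)⟩

/-- **`FL 0`**: frames of `ℒ|_{A₀ × Spec κ(t)}` from frames of the slice `ℒ|_{A₀ × x}` on `A₀`. [folklore] -/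
def framesL0 (x : AlgPoints T' ℂ) (hx : thickeningPtι T' t 0 = toSpecOver (thickeningPt T' t 0) ≫ x)
    (F : IFrames ((Scheme.Modules.pullback (sliceMor A₀ x).left).obj ℒ.L) V) : IFrames (Ln A₀ T' ℒ t 0) (Wn V 0) :=
  (F.pullback (CartesianMonoidalCategory.fst A₀.X (thickeningPt T' t 0)).left).mapIso
    ((Scheme.Modules.pullbackComp (CartesianMonoidalCategory.fst A₀.X (thickeningPt T' t 0)).left
      (sliceMor A₀ x).left).app ℒ.L ≪≫
      eqToIso (congrArg (fun k => (Scheme.Modules.pullback k).obj ℒ.L) (rn_zero_eq A₀ T' t x hx).symm))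

omit [IsLocallyNoetherian (A₀.dualOf Θ hΘ).X.left] [IsSeparated A₀.X.hom] in
/-- The Artinian factorisation of `b` through `Spec(𝒪_{Â,y₀}/𝔪)` is an isomorphism when `𝒪_{Â,y₀}/𝔪 = ℂ`.
[cite: MumfordAV1970, §13 (proof of the Thm. pp. 125–130)] -/
theorem isIso_artinianFactorOver (huniq : ∀ χ : Rt (A₀.dualOf Θ hΘ).X y₀ 0 →ₐ[ℂ] ℂ, χ = ρℂ (A₀.dualOf Θ hΘ).X y₀ hy₀ 0)
    (hbij : Function.Bijective (ρℂ (A₀.dualOf Θ hΘ).X y₀ hy₀ 0)) :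
    IsIso (artinianFactorOver (A₀.dualOf Θ hΘ).X (topPt (A₀.dualOf Θ hΘ).X y₀) b.left hb (Over.w b) 0
      maximalIdeal_complex_pow) := by
  have hρ : artinianFactor (A₀.dualOf Θ hΘ).X (topPt (A₀.dualOf Θ hΘ).X y₀) b.left hb (Over.w b) 0
      maximalIdeal_complex_pow = ρℂ (A₀.dualOf Θ hΘ).X y₀ hy₀ 0 := huniq _
  let eR : Rt (A₀.dualOf Θ hΘ).X y₀ 0 ≃+* ℂ := RingEquiv.ofBijective (ρℂ (A₀.dualOf Θ hΘ).X y₀ hy₀ 0).toRingHom hbij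
  haveI : IsIso ((Over.forget _).map (artinianFactorOver (A₀.dualOf Θ hΘ).X (topPt (A₀.dualOf Θ hΘ).X y₀) b.left
      hb (Over.w b) 0 maximalIdeal_complex_pow)) := by
    change IsIso (artinianFactorOver (A₀.dualOf Θ hΘ).X (topPt (A₀.dualOf Θ hΘ).X y₀) b.left hb (Over.w b) 0
      maximalIdeal_complex_pow).left
    rw [artinianFactorOver_left, hρ]
    exact (inferInstance : IsIso (Spec.map eR.toCommRingCatIso.hom))
  exact isIso_of_reflects_iso _ (Over.forget _)

include hb in
omit [IsLocallyNoetherian (A₀.dualOf Θ hΘ).X.left] [IsSeparated A₀.X.hom] in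
/-- **`(Spec 𝒪_{Â,y₀}/𝔪 → Â) = (Spec 𝒪_{Â,y₀}/𝔪 → Spec ℂ) ≫ b`.** [cite: MumfordAV1970, §13 (proof of the Thm. pp. 125–130)] -/
theorem thickeningPtι_zero_eq (huniq : ∀ χ : Rt (A₀.dualOf Θ hΘ).X y₀ 0 →ₐ[ℂ] ℂ, χ = ρℂ (A₀.dualOf Θ hΘ).X y₀ hy₀ 0)
    (hbij : Function.Bijective (ρℂ (A₀.dualOf Θ hΘ).X y₀ hy₀ 0)) :
    thickeningPtι (A₀.dualOf Θ hΘ).X y₀ 0 = toSpecOver (thickeningPt (A₀.dualOf Θ hΘ).X y₀ 0) ≫ b := by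
  haveI := isIso_artinianFactorOver A₀ hΘ y₀ hy₀ b hb huniq hbij
  have hfac := artinianFactorOver_comp_ι (A₀.dualOf Θ hΘ).X (topPt (A₀.dualOf Θ hΘ).X y₀) b hb 0
    maximalIdeal_complex_pow
  have hto : toSpecOver (thickeningPt (A₀.dualOf Θ hΘ).X y₀ 0) =
      inv (artinianFactorOver (A₀.dualOf Θ hΘ).X (topPt (A₀.dualOf Θ hΘ).X y₀) b.left hb (Over.w b) 0
        maximalIdeal_complex_pow) := Subsingleton.elim _ _
  rw [hto]
  exact ((IsIso.inv_comp_eq _).mpr hfac.symm).symm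

include hb in
omit [IsLocallyNoetherian (A₀.dualOf Θ hΘ).X.left] [IsSeparated A₀.X.hom] in
/-- `jB 0 = pr₁ ≫ slice_b`. [cite: MumfordAV1970, §13 (proof of the Thm. pp. 125–130)] -/
theorem jBn_zero_eq (huniq : ∀ χ : Rt (A₀.dualOf Θ hΘ).X y₀ 0 →ₐ[ℂ] ℂ, χ = ρℂ (A₀.dualOf Θ hΘ).X y₀ hy₀ 0)
    (hbij : Function.Bijective (ρℂ (A₀.dualOf Θ hΘ).X y₀ hy₀ 0)) :
    jBn A₀ hΘ y₀ 0 = (CartesianMonoidalCategory.fst A₀.X (thickeningPt (A₀.dualOf Θ hΘ).X y₀ 0)).left ≫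
      (sliceMor A₀ b).left := by
  rw [jBn, thickeningPtι_zero_eq A₀ hΘ y₀ hy₀ b hb huniq hbij, whiskerLeft_toSpecOver_comp]
  rfl

/-- **`FP 0`**: frames of `𝒫|_{A₀ × Spec κ(y₀)}` from frames of `𝒫|_{A₀ × b} ≅ ℒ|_{A₀ × x}` on `A₀`. [folklore] -/
def framesP0 (huniq : ∀ χ : Rt (A₀.dualOf Θ hΘ).X y₀ 0 →ₐ[ℂ] ℂ, χ = ρℂ (A₀.dualOf Θ hΘ).X y₀ hy₀ 0)
    (hbij : Function.Bijective (ρℂ (A₀.dualOf Θ hΘ).X y₀ hy₀ 0))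
    (F : IFrames ((Scheme.Modules.pullback (sliceMor A₀ b).left).obj P) V) :
    IFrames (PBn A₀ hΘ P y₀ 0) (fun a => (pullback.fst A₀.X.hom (sB A₀ hΘ y₀ 0)) ⁻¹ᵁ V a) :=
  (F.pullback (CartesianMonoidalCategory.fst A₀.X (thickeningPt (A₀.dualOf Θ hΘ).X y₀ 0)).left).mapIso
    ((Scheme.Modules.pullbackComp (CartesianMonoidalCategory.fst A₀.X (thickeningPt (A₀.dualOf Θ hΘ).X y₀ 0)).left
      (sliceMor A₀ b).left).app P ≪≫
      eqToIso (congrArg (fun k => (Scheme.Modules.pullback k).obj P) (jBn_zero_eq A₀ hΘ y₀ hy₀ b hb huniq hbij).symm))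

omit [LocallyOfFiniteType T'.hom] [IsLocallyNoetherian T'.left] [LocallyOfFiniteType (A₀.dualOf Θ hΘ).X.hom]
  [IsLocallyNoetherian (A₀.dualOf Θ hΘ).X.left] [IsSeparated A₀.X.hom] in
/-- **`𝒫|_{A₀ × b} ≅ ℒ|_{A₀ × x}` FOR SOME `ℂ`-POINT `b` OF `Â`** (`ℒ` fibrewise in `Pic⁰`; Mumford §8 Thm. 1 over `ℂ`: every
element of `Pic⁰(A₀)` is a slice of `𝒫`, ★ `exists_detClass_eq_detClass_pullback_sliceAt`, and rank-one modules with
the same class are isomorphic, ★ `nonempty_iso_iff_detClass_eq`). [cite: MumfordAV1970, §8 Thm. 1 (p. 77)] -/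
theorem exists_point_sliceIso (hP1 : HasRank P 1)
    (eP : Nonempty ((Scheme.Modules.pullback (AbelianVariety.Hom.toSchemeHom (A₀.oneProdPhiTheta hΘ))).obj P ≅
      mumfordSheaf A₀ Θ))
    (hℒ : ℒ.FibrewisePicZero) (x : AlgPoints T' ℂ) :
    ∃ b : AlgPoints (A₀.dualOf Θ hΘ).X ℂ,
      Nonempty ((Scheme.Modules.pullback (sliceMor A₀ b).left).obj P ≅
        (Scheme.Modules.pullback (sliceMor A₀ x).left).obj ℒ.L) := by
  have hM1 := AbelianSchemeOver.hasRank_sliceAt A₀ ℒ (x : AlgPoints (Over.mk T'.hom : SchemeOver ℂ) ℂ)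
  have hM := AbelianSchemeOver.isHomogeneous_sliceAt_of_fibrewisePicZero A₀ ℒ hℒ
    (x : AlgPoints (Over.mk T'.hom : SchemeOver ℂ) ℂ)
  obtain ⟨a, ha⟩ := exists_detClass_eq_detClass_pullback_sliceAt A₀ hΘ hP1 eP hM1 hM
  exact ⟨AlgPoints.map (A₀.phiTheta Θ hΘ).hom.hom.hom a,
    (nonempty_iso_iff_detClass_eq (hasRank_pullback _ hP1) hM1 _ _).2 ha.symm⟩

end Gamma6

end GammaInstance

end Literature.AlgebraicGeometry.Motives.AbelianVariety

end
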